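import Mathlib.Algebra.BigOperators.Intervals
import Mathlib.Algebra.BigOperators.Ring.Finset
import Mathlib.Algebra.Order.BigOperators.Group.Finset
import Mathlib.Data.Finset.Powerset
import Mathlib.Data.Finset.Max
import Mathlib.Data.Nat.Choose.Sum
import Mathlib.Data.Nat.Factorial.Basic
import Mathlib.RingTheory.MvPolynomial.Symmetric.Defs
import Mathlib.RingTheory.Polynomial.Vieta
import Mathlib.NumberTheory.Padics.PadicVal.Basic
import Mathlib.Tactic.Ring
import Mathlib.Tactic.LinearCombination
import Mathlib.Tactic.NormNum
import HarnessLib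

/-!
# Venture HSemireg — S4-PUSH corner 2 (twisted sheaves ∕ complexes at `n = 6`), seat `gs-eng-2` (gen 24):
# KERNEL LEG for the CRITERION STEP of THEOREM TIGHT ∕ THEOREM TIGHT-3 — divided powers of a sum of
# commuting square-zero elements, the exponential law, the binomial transform, and the valuation reading
# (cell record: this seat's `general-structure/XCHECK-K0-gs2.md` §4b (CRITERION), §4c, §4d (CRITERION);
# s4-search-2's `s4push/search-2/PREREG-S2-17.md` ∕ S4-PR-51 (T7))

HONEST FRAMING. Count-neutral infrastructure; commutative algebra over an arbitrary commutative ring `R` and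
elementary divisibility over `ℤ`; NO definition is introduced (`D^{[j]}` is Mathlib's `Multiset.esymm`, all
other sums are written out). Nothing here says HC ∕ HC_CM ∕ HC_AV holds; no object, no `σ`, no census count
moves. NOT formalised here (as in the sister leaves `DualSieveDegreeFour`, `DividedSquareUniqueness`,
`DividedSquareLemma`, `DualSieveArithmetic`): the lattice-to-coordinates translation — that the even forms of
`∧Λ′^∨` generate a commutative ring in which the slot forms `h_i = a_i^* ∧ b_i^*` of a `D`-adapted basis (and
the monomials of any integral `2`-form) square to zero, that the `h_J` (`#J = j`) are part of a basis of
`∧^{2j} Λ′^∨` — and the uniqueness step `B′ ≡ εD (mod ∧²Λ_Y^∨)` (kernel-checked in `DividedSquareUniqueness.lean`).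
What IS formalised, for `D = Σ m`, `m` a finite multiset of elements of `R` with `x² = 0` for `x ∈ m`:
* §1 the DIVIDED POWERS `D^{[j]} := e_j(m) = m.esymm j` (the square-free part of the multinomial expansion)
  satisfy the DIVIDED-POWER LAW `D^{[a]} · D^{[b]} = C(a+b, a) · D^{[a+b]}` (`esymm_mul_esymm`), `D^j = j! · D^{[j]}`
  (`pow_eq_factorial_mul_esymm`: no division, valid over `ℤ`, `ℤ∕p^k`, `𝔽_p`), `D^{[j]} = 0` for `j > #m`,
  `(εD)^{[j]} = ε^j D^{[j]}`, and with slot weights `h_i = u^{c_i} h′_i` (a TYPE `c`): `D^{[j]} = Σ_{#J=j} u^{c_J} h′_J`,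
  `c_J := Σ_{i∈J} c_i` (`esymm_slotWeights`; §4d «`D^{[j]} = Σ_{|J|=j} 3^{c′_J} h_J`»);
* §2 the CAUCHY PRODUCT (`sum_mul_esymm_mul_sum_mul_esymm`): `(Σ_i a_i D^{[i]})(Σ_k b_k D^{[k]}) =
  Σ_j (Σ_{k≤j} C(j,k) a_{j−k} b_k) D^{[j]}`; the truncated exponential `e^{εD} := Σ_{j≤#m} ε^j D^{[j]}` IS THE
  PRODUCT `∏_{x∈m} (1 + εx)` (`exp_eq_prod`, Vieta at `X = 1`, no hypothesis), hence the EXPONENTIAL LAWS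
  `e^{D₁} e^{D₂} = e^{D₁+D₂}` for two slot multisets (`prod_one_add_mul_prod_one_add`, no hypothesis) and
  `e^{εD} e^{ε′D} = e^{(ε+ε′)D}` (`exp_mul_exp`), and `e^{δ}` is a UNIT with inverse `e^{−δ} = ∏ (1 − x)` for EVERY
  sum `δ` of square-zero elements (`prod_one_add_mul_prod_one_sub`, `isUnit_prod_one_add`, `isUnit_exp`) — §4d's
  «`e^{−δ}` is a unit of `∧^{ev} Λ_Y^∨`», so the design condition depends on `B′` only modulo `∧²Λ_Y^∨`; and the
  BINOMIAL TRANSFORM of §4b ∕ §4c ∕ §4d (`exp_neg_mul_sum`): `e^{−εD} · Σ_k σ_k D^{[k]} = Σ_j σ^{(ε)}_j D^{[j]}`,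
  `σ^{(ε)}_j = Σ_{k≤j} C(j,k) (−ε)^{j−k} σ_k` (so `(e^{−εD} w)_{2j} = σ^{(ε)}_j D^{[j]}` in the graded ring), with
  `σ^{(ε)}_3 = σ₃ − ε(3σ₂ + σ₀)` when `σ₁ = 0`, `ε² = 1` (`transform_three`: the `j = 3` obstruction displayed in
  §4d) and `σ^{(ε)}_2 = σ₂ + σ₀` even for odd `σ₀, σ₂` (`two_dvd_transform_two`: «`v₂(σ′₂) ≥ 1` always», §4b);
* §3 the VALUATION READING: `p^t ∣ σ · p^m ⟺ p^{t−m} ∣ σ` (`pow_dvd_mul_pow_iff`, `m ≤ t`), `⟺ t ≤ v_p(σ) + m`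
  (`pow_dvd_mul_pow_iff_le_padicValInt_add`); for a type `c` sorted increasingly the least exponent among the
  monomials of `D^{[j]}` is the PREFIX SUM `m_j(c) = Σ_{i<j} c_i` («the sum of the `j` smallest entries»,
  `sum_range_le_sum_of_monotone`), so «`σ · D^{[j]} ∈ p^t ∧^{2j}` coefficientwise» `⟺ p^t ∣ σ p^{m_j(c)}`
  (`forall_pow_dvd_iff_prefix`); THEOREM TIGHT's line (type `1^n`, `m_j = j`, `t = 2j − 1`): `⟺ p^{j−1} ∣ σ^{(ε)}_j`
  (`tight_criterion_iff`), TIGHT-3's: `⟺ p^{2j−1−m_j} ∣ σ^{(ε)}_j` (`tight3_criterion_iff`); census constants: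
  `(1⁴,2²)`: `m_j = 1,2,3,4,6,8`, thresholds `2j−1−m_j = 0,1,2,3,3,3` (§4c); `(1⁵,2)`: `…,5,7`; `(1⁵,3)`: `…,5,8`.
References: even elements central, `(x∧y)² = 0`, divided powers of a `2`-form [cite: BourbakiAlgebre1a3,
Ch. III §7 no. 1]; `e_{j+1}(a ∷ m) = e_{j+1}(m) + a e_j(m)` is folklore (also
`Literature.NumberTheory.Automorphic.multiset_esymm_cons_succ`, not imported to keep this leaf light).
-/

namespace Summit.Ventures.HSemireg.DividedPowerBinomialTransform

variable {R : Type*} [CommRing R]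

/-! ### §1 Divided powers `D^{[j]} := e_j(m)` of `D = Σ m` for a multiset `m` of square-zero elements -/

/-- `D^{[0]} = e_0(m) = 1`. [folklore] -/
theorem esymm_zero_right (m : Multiset R) : m.esymm 0 = 1 := by
  simp [Multiset.esymm, Multiset.powersetCard_zero_left]

/-- `D^{[1]} = e_1(m) = Σ m = D`. [folklore] -/
theorem esymm_one_right (m : Multiset R) : m.esymm 1 = m.sum := by
  simp [Multiset.esymm, Multiset.powersetCard_one, Multiset.map_map]

/-- `D^{[j]} = 0` for `j > #m` (there are no `j`-sub-multisets). [folklore] -/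
theorem esymm_eq_zero_of_card_lt {m : Multiset R} {j : ℕ} (hj : Multiset.card m < j) : m.esymm j = 0 := by
  simp [Multiset.esymm, Multiset.powersetCard_eq_empty _ hj]

/-- Recursion in the slots: `(D + a)^{[j+1]} = D^{[j+1]} + a · D^{[j]}`, i.e.
`e_{j+1}(a ∷ m) = e_{j+1}(m) + a · e_j(m)`. [folklore] -/
theorem esymm_cons_succ (a : R) (m : Multiset R) (j : ℕ) :
    (a ::ₘ m).esymm (j + 1) = m.esymm (j + 1) + a * m.esymm j := by
  simp only [Multiset.esymm, Multiset.powersetCard_cons, Multiset.map_add, Multiset.sum_add,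
    Multiset.map_map, Function.comp_def, Multiset.prod_cons]
  rw [← Multiset.sum_map_mul_left]

/-- **The divided-power law** `D^{[a]} · D^{[b]} = C(a+b, a) · D^{[a+b]}` for square-zero slot forms in a
commutative ring: in the product of the two elementary symmetric functions only the products over DISJOINT
index sets survive (`h_i² = 0`), and each `(a+b)`-set splits into an `a`-set and a `b`-set in `C(a+b, a)`
ways. (Proof by the slot recursion and Pascal's rule.) -/
theorem esymm_mul_esymm {m : Multiset R} (h0 : ∀ x ∈ m, x * x = 0) (a b : ℕ) :
    m.esymm a * m.esymm b = (((a + b).choose a : ℕ) : R) * m.esymm (a + b) := by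
  induction m using Multiset.induction_on generalizing a b with
  | empty =>
    rcases a with _ | a
    · simp [esymm_zero_right]
    · rw [esymm_eq_zero_of_card_lt (by simp), zero_mul,
        esymm_eq_zero_of_card_lt (by simp only [Multiset.card_zero]; omega), mul_zero]
  | cons x m ih =>
    have h0m : ∀ y ∈ m, y * y = 0 := fun y hy => h0 y (Multiset.mem_cons_of_mem hy)
    have hxx : x * x = 0 := h0 x (Multiset.mem_cons_self x m)
    rcases a with _ | a
    · simp [esymm_zero_right]
    rcases b with _ | b
    · simp [esymm_zero_right]
    have e1 := ih h0m (a + 1) (b + 1)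
    have e2 := ih h0m a (b + 1)
    have e3 := ih h0m (a + 1) b
    rw [show a + 1 + (b + 1) = a + b + 1 + 1 by omega] at e1 ⊢
    rw [show a + (b + 1) = a + b + 1 from rfl] at e2
    rw [Nat.add_right_comm a 1 b] at e3
    have e4 : (((a + b + 1 + 1).choose (a + 1) : ℕ) : R)
        = (((a + b + 1).choose a : ℕ) : R) + (((a + b + 1).choose (a + 1) : ℕ) : R) := by
      rw [Nat.choose_succ_succ]; push_cast; ring
    rw [esymm_cons_succ, esymm_cons_succ, esymm_cons_succ]
    linear_combination e1 + x * e2 + x * e3 - x * m.esymm (a + b + 1) * e4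
      + m.esymm a * m.esymm b * hxx

/-- `D^j = j! · D^{[j]}`: the name «divided power» is deserved (no division is performed, so this holds over
`ℤ`, `ℤ∕p^k`, `𝔽_p`). -/
theorem pow_eq_factorial_mul_esymm {m : Multiset R} (h0 : ∀ x ∈ m, x * x = 0) (j : ℕ) :
    m.sum ^ j = ((j.factorial : ℕ) : R) * m.esymm j := by
  induction j with
  | zero => simp [esymm_zero_right]
  | succ j ih =>
    rw [pow_succ, ih, ← esymm_one_right m, mul_assoc, esymm_mul_esymm h0 j 1, Nat.choose_succ_self_right,
      Nat.factorial_succ]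
    push_cast; ring

/-- Scalars: `(εD)^{[j]} = ε^j · D^{[j]}` (Mathlib's `Multiset.pow_smul_esymm`). -/
theorem esymm_map_mul_left (ε : R) (m : Multiset R) (j : ℕ) :
    (m.map (fun x => ε * x)).esymm j = ε ^ j * m.esymm j := by
  simpa only [smul_eq_mul] using (Multiset.pow_smul_esymm ε j m).symm

/-- Slot weights (a TYPE `c` on slots indexed by `s`): with `h_i = u^{c_i} · h′_i`,
`D^{[j]} = Σ_{J ⊆ s, #J = j} u^{c_J} · ∏_{i∈J} h′_i`, `c_J := Σ_{i∈J} c_i` — on `Λ′` of type `c′` the monomial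
`h′_J` of `D^{[j]}` carries exactly `p^{c′_J}` (§4d). -/
theorem esymm_slotWeights {ι : Type*} (s : Finset ι) (u : R) (c : ι → ℕ) (h' : ι → R) (j : ℕ) :
    (s.val.map (fun i => u ^ c i * h' i)).esymm j
      = ∑ J ∈ s.powersetCard j, u ^ (∑ i ∈ J, c i) * ∏ i ∈ J, h' i := by
  rw [Finset.esymm_map_val]
  refine Finset.sum_congr rfl fun J _ => ?_
  rw [Finset.prod_mul_distrib, Finset.prod_pow_eq_pow_sum]

/-! ### §2 The Cauchy product of divided-power series, the exponential law, the binomial transform -/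

/-- **Cauchy product with binomial weights.** For square-zero slot forms and any coefficient sequences `a, b`
(sums truncated at any `N ≥ #m`, beyond which `D^{[j]} = 0`):
`(Σ_{i≤N} a_i D^{[i]}) · (Σ_{k≤N} b_k D^{[k]}) = Σ_{j≤N} (Σ_{k≤j} C(j,k) a_{j−k} b_k) · D^{[j]}`. -/
theorem sum_mul_esymm_mul_sum_mul_esymm {m : Multiset R} (h0 : ∀ x ∈ m, x * x = 0) {N : ℕ}
    (hN : Multiset.card m ≤ N) (a b : ℕ → R) :
    (∑ i ∈ Finset.range (N + 1), a i * m.esymm i) * (∑ k ∈ Finset.range (N + 1), b k * m.esymm k)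
      = ∑ j ∈ Finset.range (N + 1),
          (∑ k ∈ Finset.range (j + 1), ((j.choose k : ℕ) : R) * (a (j - k) * b k)) * m.esymm j := by
  have hz : ∀ j, N < j → m.esymm j = 0 := fun j hj => esymm_eq_zero_of_card_lt (lt_of_le_of_lt hN hj)
  set g : ℕ → ℕ → R := fun j k => ((j.choose k : ℕ) : R) * (a (j - k) * b k) * m.esymm j with hg
  have step1 : ∀ i k, a i * m.esymm i * (b k * m.esymm k) = g (k + i) k := by
    intro i k; rw [hg]; dsimp only
    rw [show a i * m.esymm i * (b k * m.esymm k) = a i * b k * (m.esymm i * m.esymm k) by ring,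
      esymm_mul_esymm h0, Nat.choose_symm_add, Nat.add_sub_cancel_left, Nat.add_comm i k]
    ring
  have step2 : ∀ k ∈ Finset.range (N + 1),
      ∑ i ∈ Finset.range (N + 1), g (k + i) k = ∑ j ∈ Finset.range (N + 1), if k ≤ j then g j k else 0 := by
    intro k hk
    have hk' : k ≤ N + 1 := (Finset.mem_range.1 hk).le
    have e1 : ∑ i ∈ Finset.range (N + 1), g (k + i) k = ∑ j ∈ Finset.Ico k (k + (N + 1)), g j k := by
      rw [Finset.sum_Ico_eq_sum_range, Nat.add_sub_cancel_left]
    have e2 : ∑ j ∈ Finset.Ico k (k + (N + 1)), g j k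
        = ∑ j ∈ Finset.Ico k (N + 1), g j k + ∑ j ∈ Finset.Ico (N + 1) (k + (N + 1)), g j k :=
      (Finset.sum_Ico_consecutive _ hk' (by omega)).symm
    have e3 : ∑ j ∈ Finset.Ico (N + 1) (k + (N + 1)), g j k = 0 := by
      refine Finset.sum_eq_zero fun j hj => ?_
      rw [hg]
      dsimp only
      rw [hz j (Finset.mem_Ico.1 hj).1, mul_zero]
    have e4 : Finset.Ico k (N + 1) = (Finset.range (N + 1)).filter (fun j => k ≤ j) := by
      ext j
      simp only [Finset.mem_Ico, Finset.mem_filter, Finset.mem_range]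
      constructor
      · rintro ⟨h1, h2⟩; exact ⟨h2, h1⟩
      · rintro ⟨h1, h2⟩; exact ⟨h2, h1⟩
    rw [e1, e2, e3, add_zero, e4, Finset.sum_filter]
  rw [Finset.sum_mul_sum]
  simp_rw [step1]
  rw [Finset.sum_comm, Finset.sum_congr rfl step2, Finset.sum_comm]
  refine Finset.sum_congr rfl fun j hj => ?_
  have hj' : j < N + 1 := Finset.mem_range.1 hj
  have e5 : (Finset.range (N + 1)).filter (fun k => k ≤ j) = Finset.range (j + 1) := by
    ext k
    simp only [Finset.mem_filter, Finset.mem_range]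
    constructor
    · rintro ⟨-, h2⟩; omega
    · intro h1; exact ⟨by omega, by omega⟩
  rw [← Finset.sum_filter, e5, Finset.sum_mul]

/-- **`e^{D} = ∏_{x∈m} (1 + x)`**: the truncated exponential `Σ_{j ≤ #m} D^{[j]}` is the product of the one-slot
exponentials `e^{h} = 1 + h` — Vieta's formula at `X = 1`; NO hypothesis on `m`. -/
theorem sum_esymm_eq_prod_one_add (m : Multiset R) :
    ∑ j ∈ Finset.range (Multiset.card m + 1), m.esymm j = (m.map (fun x => 1 + x)).prod := by
  have h := congrArg (Polynomial.eval 1) (Multiset.prod_X_add_C_eq_sum_esymm m)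
  rw [Polynomial.eval_multiset_prod, Multiset.map_map, Polynomial.eval_finsetSum] at h
  simp only [Function.comp_def, Polynomial.eval_add, Polynomial.eval_X, Polynomial.eval_C,
    Polynomial.eval_mul, Polynomial.eval_pow, one_pow, mul_one] at h
  exact h.symm

/-- The truncated EXPONENTIAL `e^{εD} := Σ_{j ≤ #m} ε^j · D^{[j]}` (`= Σ_j (εD)^j ∕ j!` where `j!` is invertible;
all higher divided powers vanish) **is the product `∏_{x∈m} (1 + εx)`** (no hypothesis on `m`). `ε = −1`: the
`e^{−D}` of THEOREM TIGHT (`B′ = D`); `ε = ∓1`: §4c ∕ THEOREM TIGHT-3 (`B′ = ±D`). -/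
theorem exp_eq_prod (m : Multiset R) (ε : R) :
    ∑ j ∈ Finset.range (Multiset.card m + 1), ε ^ j * m.esymm j = (m.map (fun x => 1 + ε * x)).prod := by
  have h := sum_esymm_eq_prod_one_add (m.map (fun x => ε * x))
  rw [Multiset.card_map, Multiset.map_map] at h
  simpa only [Function.comp_def, esymm_map_mul_left] using h

/-- **Exponential law for two slot multisets** (no hypothesis): `e^{D₁} · e^{D₂} = e^{D₁ + D₂}` for `D₁ = Σ m₁`,
`D₂ = Σ m₂`, `D₁ + D₂ = Σ (m₁ + m₂)` — in product form. With `m₂` = the monomials `n_{kl} · x_k ∧ x_l` of an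
ARBITRARY integral `2`-form `δ` (each square-zero, pairwise commuting) this is §4d's `e^{−(B′+δ)} = e^{−B′} · e^{−δ}`. -/
theorem prod_one_add_mul_prod_one_add (m₁ m₂ : Multiset R) :
    (m₁.map (fun x => 1 + x)).prod * (m₂.map (fun x => 1 + x)).prod
      = ((m₁ + m₂).map (fun x => 1 + x)).prod := by
  rw [Multiset.map_add, Multiset.prod_add]

/-- **`e^{δ}` is a unit for EVERY sum `δ = Σ m` of square-zero elements** (so for every integral `2`-form, via its
monomials): `∏ (1 + x) · ∏ (1 − x) = ∏ (1 − x²) = 1` — §4d's sentence «`e^{−δ}`, `δ ∈ ∧²Λ_Y^∨`, is a unit of the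
ring `∧^{ev} Λ_Y^∨`», whence the design condition `p · e^{−B′} w ∈ ∧Λ_Y^∨` depends on `B′` only modulo `∧²Λ_Y^∨`. -/
theorem prod_one_add_mul_prod_one_sub {m : Multiset R} (h0 : ∀ x ∈ m, x * x = 0) :
    (m.map (fun x => 1 + x)).prod * (m.map (fun x => 1 - x)).prod = 1 := by
  rw [← Multiset.prod_map_mul, Multiset.map_congr rfl (fun x hx => show (1 + x) * (1 - x) = (1 : R) by
    linear_combination (-1 : R) * h0 x hx), Multiset.prod_map_one]

/-- `IsUnit (∏_{x∈m} (1 + x))` for square-zero `m` (inverse `∏ (1 − x)`). -/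
theorem isUnit_prod_one_add {m : Multiset R} (h0 : ∀ x ∈ m, x * x = 0) :
    IsUnit (m.map (fun x => 1 + x)).prod :=
  IsUnit.of_mul_eq_one _ (prod_one_add_mul_prod_one_sub h0)

/-- **Exponential law in one `D`**: `e^{εD} · e^{ε′D} = e^{(ε+ε′)D}` for square-zero slot forms
(`(1 + εx)(1 + ε′x) = 1 + (ε + ε′)x` slot by slot). -/
theorem exp_mul_exp {m : Multiset R} (h0 : ∀ x ∈ m, x * x = 0) (ε ε' : R) :
    (∑ j ∈ Finset.range (Multiset.card m + 1), ε ^ j * m.esymm j)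
        * (∑ j ∈ Finset.range (Multiset.card m + 1), ε' ^ j * m.esymm j)
      = ∑ j ∈ Finset.range (Multiset.card m + 1), (ε + ε') ^ j * m.esymm j := by
  rw [exp_eq_prod, exp_eq_prod, exp_eq_prod, ← Multiset.prod_map_mul]
  exact congrArg _ (Multiset.map_congr rfl fun x hx => by linear_combination (ε * ε') * h0 x hx)

/-- `e^{0·D} = D^{[0]} = 1`. -/
theorem exp_zero (m : Multiset R) :
    ∑ j ∈ Finset.range (Multiset.card m + 1), (0 : R) ^ j * m.esymm j = 1 := by
  rw [Finset.sum_range_succ']; simp [esymm_zero_right]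

/-- `e^{−εD} · e^{εD} = 1`. -/
theorem exp_neg_mul_exp {m : Multiset R} (h0 : ∀ x ∈ m, x * x = 0) (ε : R) :
    (∑ j ∈ Finset.range (Multiset.card m + 1), (-ε) ^ j * m.esymm j)
        * (∑ j ∈ Finset.range (Multiset.card m + 1), ε ^ j * m.esymm j) = 1 := by
  rw [exp_mul_exp h0, neg_add_cancel, exp_zero]

/-- **`e^{εD}` is a unit** (inverse `e^{−εD}`). -/
theorem isUnit_exp {m : Multiset R} (h0 : ∀ x ∈ m, x * x = 0) (ε : R) :
    IsUnit (∑ j ∈ Finset.range (Multiset.card m + 1), ε ^ j * m.esymm j) :=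
  IsUnit.of_mul_eq_one (∑ j ∈ Finset.range (Multiset.card m + 1), (-ε) ^ j * m.esymm j)
    (by rw [mul_comm]; exact exp_neg_mul_exp h0 ε)

/-- **The binomial transform** (§4b CRITERION with `ε = 1`; §4c ∕ §4d with `ε = ±1`):
`e^{−εD} · Σ_{k ≤ #m} σ_k D^{[k]} = Σ_{j ≤ #m} σ^{(ε)}_j · D^{[j]}`, `σ^{(ε)}_j := Σ_{k≤j} C(j,k) (−ε)^{j−k} σ_k`.
In the graded ring `∧^{ev} Λ′^∨` (`D^{[j]}` of degree `2j`) this says `(e^{−εD} w)_{2j} = σ^{(ε)}_j · D^{[j]}`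
for the STRUCTURE-LEMMA element `w = Σ_k σ_k D^{[k]}`. -/
theorem exp_neg_mul_sum {m : Multiset R} (h0 : ∀ x ∈ m, x * x = 0) (ε : R) (σ : ℕ → R) :
    (∑ j ∈ Finset.range (Multiset.card m + 1), (-ε) ^ j * m.esymm j)
        * ∑ k ∈ Finset.range (Multiset.card m + 1), σ k * m.esymm k
      = ∑ j ∈ Finset.range (Multiset.card m + 1),
          (∑ k ∈ Finset.range (j + 1), ((j.choose k : ℕ) : R) * ((-ε) ^ (j - k) * σ k)) * m.esymm j :=
  sum_mul_esymm_mul_sum_mul_esymm h0 le_rfl _ _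

/-- The transform written out: `σ^{(ε)}_2 = σ₂ − 2εσ₁ + ε²σ₀`, `σ^{(ε)}_3 = σ₃ − 3εσ₂ + 3ε²σ₁ − ε³σ₀`. -/
theorem transform_two_three (ε : R) (σ : ℕ → R) :
    (∑ k ∈ Finset.range (2 + 1), (((2 : ℕ).choose k : ℕ) : R) * ((-ε) ^ (2 - k) * σ k))
        = σ 2 - 2 * ε * σ 1 + ε ^ 2 * σ 0 ∧
    (∑ k ∈ Finset.range (3 + 1), (((3 : ℕ).choose k : ℕ) : R) * ((-ε) ^ (3 - k) * σ k))
        = σ 3 - 3 * ε * σ 2 + 3 * ε ^ 2 * σ 1 - ε ^ 3 * σ 0 := by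
  constructor <;> simp [Finset.sum_range_succ, Nat.choose] <;> ring

/-- **The `j = 3` obstruction of §4c ∕ §4d in its displayed form**: for `ε² = 1` and `σ₁ = 0`,
`σ^{(ε)}_3 = σ₃ − ε (3σ₂ + σ₀)` (so the criterion at `j = 3` reads `v₃(σ₃ − ε(3σ₂ + σ₀)) + m₃ ≥ 5`). -/
theorem transform_three {ε : R} (hε : ε ^ 2 = 1) {σ : ℕ → R} (hσ : σ 1 = 0) :
    (∑ k ∈ Finset.range (3 + 1), (((3 : ℕ).choose k : ℕ) : R) * ((-ε) ^ (3 - k) * σ k))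
      = σ 3 - ε * (3 * σ 2 + σ 0) := by
  rw [(transform_two_three ε σ).2, hσ]
  linear_combination (-(ε * σ 0)) * hε

/-- **«`v₂(σ′₂) ≥ 1` always holds»** (§4b): with `σ₁ = 0`, `ε² = 1` and `σ₀, σ₂` odd, `σ^{(ε)}_2 = σ₂ + σ₀`
is even. -/
theorem two_dvd_transform_two {ε : ℤ} (hε : ε ^ 2 = 1) {σ : ℕ → ℤ} (hσ : σ 1 = 0) (h0 : Odd (σ 0))
    (h2 : Odd (σ 2)) :
    (2 : ℤ) ∣ ∑ k ∈ Finset.range (2 + 1), (((2 : ℕ).choose k : ℕ) : ℤ) * ((-ε) ^ (2 - k) * σ k) := by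
  rw [(transform_two_three ε σ).1, hσ, hε, mul_zero, sub_zero, one_mul]
  exact (h2.add_odd h0).two_dvd

/-! ### §3 The valuation reading -/

section Valuation

variable {p : ℕ} [hp : Fact p.Prime]

/-- Powers of `p` are non-zero integers. -/
private theorem pow_ne_zero_int (n : ℕ) : (p : ℤ) ^ n ≠ 0 :=
  pow_ne_zero n (by exact_mod_cast hp.out.ne_zero)

/-- **Cancellation**: for `m ≤ t`, `p^t ∣ σ · p^m ⟺ p^{t−m} ∣ σ`. In the sieve: the `h′_J`-coefficient of
`σ · D^{[j]}` on `Λ′` is `σ · p^{c′_J}`, and membership in `p^{t} ∧^{2j} Λ′^∨` (`t = 2j − 1`) is read this way. -/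
theorem pow_dvd_mul_pow_iff {σ : ℤ} {t m : ℕ} (hmt : m ≤ t) :
    (p : ℤ) ^ t ∣ σ * (p : ℤ) ^ m ↔ (p : ℤ) ^ (t - m) ∣ σ := by
  obtain ⟨d, rfl⟩ := Nat.exists_eq_add_of_le hmt
  rw [Nat.add_sub_cancel_left, pow_add, mul_comm σ]
  exact mul_dvd_mul_iff_left (pow_ne_zero_int m)

/-- **The valuation form**: for `σ ≠ 0`, `p^t ∣ σ · p^m ⟺ t ≤ v_p(σ) + m`. -/
theorem pow_dvd_mul_pow_iff_le_padicValInt_add {σ : ℤ} (hσ : σ ≠ 0) (t m : ℕ) :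
    (p : ℤ) ^ t ∣ σ * (p : ℤ) ^ m ↔ t ≤ padicValInt p σ + m := by
  rw [padicValInt_dvd_iff, padicValInt.mul hσ (pow_ne_zero_int m)]
  have hv : padicValInt p ((p : ℤ) ^ m) = m := by
    rw [show ((p : ℤ) ^ m) = ((p ^ m : ℕ) : ℤ) by push_cast; rfl, padicValInt.of_nat,
      padicValNat.prime_pow]
  rw [hv]
  exact or_iff_right (mul_ne_zero hσ (pow_ne_zero_int m))

/-- **«The sum of the `j` smallest entries»**: for a type `c : ℕ → ℕ` sorted increasingly (slots indexed by
`ℕ`), every `j`-set of slots `J` has `Σ_{i<j} c_i ≤ Σ_{i∈J} c_i` — the prefix sum `m_j(c)` is the least exponent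
among the monomials of `D^{[j]}` (§4d). (Induction on `j`: remove the largest slot `M ∈ J`; `M ≥ j − 1`.) -/
theorem sum_range_le_sum_of_monotone {c : ℕ → ℕ} (hc : Monotone c) :
    ∀ (j : ℕ) (J : Finset ℕ), J.card = j → ∑ i ∈ Finset.range j, c i ≤ ∑ i ∈ J, c i
  | 0, J, _ => by simp
  | j + 1, J, hJ => by
    have hne : J.Nonempty := by rw [← Finset.card_pos, hJ]; exact Nat.succ_pos j
    have hMJ : J.max' hne ∈ J := Finset.max'_mem J hne
    have hcard : (J.erase (J.max' hne)).card = j := by rw [Finset.card_erase_of_mem hMJ, hJ]; rfl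
    have ih := sum_range_le_sum_of_monotone hc j (J.erase (J.max' hne)) hcard
    have hjM : j ≤ J.max' hne := by
      have hsub : J ⊆ Finset.range (J.max' hne + 1) := fun x hx =>
        Finset.mem_range.2 (Nat.lt_succ_of_le (J.le_max' x hx))
      have := Finset.card_le_card hsub
      rw [hJ, Finset.card_range] at this
      omega
    have hmono := hc hjM
    rw [Finset.sum_range_succ, ← Finset.add_sum_erase J c hMJ]
    omega

omit hp in
/-- **Coefficientwise reading over a sorted type** (§4d CRITERION, THEOREM TIGHT-3): for `c` sorted and the
slot set `s ⊇ {0,…,j−1}`, «`p^t` divides `σ · p^{c_J}` for EVERY `j`-subset `J ⊆ s`» `⟺` «`p^t ∣ σ · p^{m_j(c)}`»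
with `m_j(c) = Σ_{i<j} c_i`; combined with `pow_dvd_mul_pow_iff` this is `v_p(σ) + m_j(c) ≥ t`. -/
theorem forall_pow_dvd_iff_prefix {c : ℕ → ℕ} (hc : Monotone c) {s : Finset ℕ} {j : ℕ}
    (hjs : Finset.range j ⊆ s) (σ : ℤ) (t : ℕ) :
    (∀ J ∈ s.powersetCard j, (p : ℤ) ^ t ∣ σ * (p : ℤ) ^ (∑ i ∈ J, c i)) ↔
      (p : ℤ) ^ t ∣ σ * (p : ℤ) ^ (∑ i ∈ Finset.range j, c i) := by
  refine ⟨fun H => H _ (Finset.mem_powersetCard.2 ⟨hjs, Finset.card_range j⟩), fun H J hJ => ?_⟩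
  exact H.trans (mul_dvd_mul_left σ
    (pow_dvd_pow _ (sum_range_le_sum_of_monotone hc j J (Finset.mem_powersetCard.1 hJ).2)))

/-- **THEOREM TIGHT's line** (§4b; type `1^n`, so `c_J = #J = j` for every `j`-set and `m_j = j`;
`t = 2j − 1`): for `j ≥ 1`,
`p^{2j−1} ∣ σ^{(ε)}_j · p^j ⟺ p^{j−1} ∣ σ^{(ε)}_j`, i.e. `v_p(σ′_j) ≥ j − 1`. -/
theorem tight_criterion_iff {σ : ℤ} {j : ℕ} (hj : 1 ≤ j) :
    (p : ℤ) ^ (2 * j - 1) ∣ σ * (p : ℤ) ^ j ↔ (p : ℤ) ^ (j - 1) ∣ σ := by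
  rw [pow_dvd_mul_pow_iff (p := p) (by omega : j ≤ 2 * j - 1),
    show 2 * j - 1 - j = j - 1 by omega]

/-- **THEOREM TIGHT-3's line** (§4d; general sorted type, `t = 2j − 1`, `m := m_j(c′) ≤ 2j − 1`):
`p^{2j−1} ∣ σ · p^{m} ⟺ p^{2j−1−m} ∣ σ`, i.e. `v_p(σ^{(ε)}_j) + m_j(c′) ≥ 2j − 1`. -/
theorem tight3_criterion_iff {σ : ℤ} {j m : ℕ} (hm : m ≤ 2 * j - 1) :
    (p : ℤ) ^ (2 * j - 1) ∣ σ * (p : ℤ) ^ m ↔ (p : ℤ) ^ (2 * j - 1 - m) ∣ σ :=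
  pow_dvd_mul_pow_iff hm

end Valuation

/-! ### §3b The census constants of §4c ∕ §4d ∕ §4e (types on six slots `0, …, 5`, sorted) -/

/-- Type `(1⁴, 2²)` = `c = (1,1,1,1,2,2)`: prefix sums `m_j = 1, 2, 3, 4, 6, 8` (`j = 1, …, 6`; `m_0 = 0`). -/
theorem prefix_oneFourTwoTwo :
    (List.range 7).map (fun j => ∑ i ∈ Finset.range j, (if i < 4 then 1 else 2 : ℕ)) = [0, 1, 2, 3, 4, 6, 8] := by
  decide

/-- Two-step types `(a^k, b^{n−k})` with `a ≤ b` — `(1⁴,2²)`, `(1⁵,2)`, `(1⁵,3)`, `1^n` — are sorted. -/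
theorem monotone_twoStep {a b : ℕ} (hab : a ≤ b) (k : ℕ) : Monotone (fun i : ℕ => (if i < k then a else b)) := by
  intro i j hij
  dsimp only
  split_ifs <;> omega

/-- Type `(1⁴, 2²)`: the thresholds `2j − 1 − m_j = 0, 1, 2, 3, 3, 3` (`j = 1, …, 6`) of §4c. -/
theorem threshold_oneFourTwoTwo :
    (List.range 6).map (fun j => 2 * (j + 1) - 1 - ∑ i ∈ Finset.range (j + 1), (if i < 4 then 1 else 2 : ℕ))
      = [0, 1, 2, 3, 3, 3] := by
  decide

/-- Type `(1⁵, 2)`: prefix sums `m_j = 1, 2, 3, 4, 5, 7`; type `(1⁵, 3)`: `m_j = 1, 2, 3, 4, 5, 8` (§4d, §4e). -/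
theorem prefix_oneFiveTwo_oneFiveThree :
    (List.range 7).map (fun j => ∑ i ∈ Finset.range j, (if i < 5 then 1 else 2 : ℕ)) = [0, 1, 2, 3, 4, 5, 7] ∧
    (List.range 7).map (fun j => ∑ i ∈ Finset.range j, (if i < 5 then 1 else 3 : ℕ)) = [0, 1, 2, 3, 4, 5, 8] := by
  decide

end Summit.Ventures.HSemireg.DividedPowerBinomialTransform
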